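import Summits.BirchSwinnertonDyer.BirchSwinnertonDyer.Theorems.ThetaPartnerAtTwoSignedKatoUpToAtTwoKatoBKCuspBrick
import Literature.NumberTheory.EllipticCurves.RohrlichNonvanishingRankinProofs
import HarnessLib

/-!
# Route `ThetaPartnerAtTwo` (TP2) / `ResidualThetaTransportAtTwo` (RTT), crux K3 `SignedKatoDivisibilityUpToAtTwo`
# (item stmt-BirchSwinnertonDyer-20308) and its twin K3P′ `SignedKatoDivisibilityUpToAtTwoOfPub` (stmt-BirchSwinnertonDyer-25631),
# line `colemanrat` v13 — brick B1 and the odd-twist supply with NO named fact (Rohrlich's theorem is DISCHARGED in the tree),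
# in the shapes consumed by the socket «Kato's zeta values + (C6) Bloch–Kato reciprocity on THE layer pairing ⟹ CORE_pairχ^prim»

Width seat `bsd-wall-tp2-p2x-w2` g7 (cell `bsd-wall`). HONEST FRAMING: compositions only (no definition, no named fact, no instance,
no `sorry`); every theorem is an implication DISPLAYING its hypothesis; closes no item; K3 / K3P′ are NOT settled and BSD is NOT
proved by any of this.

## What is here

* §0 `OddTwistSupply.exists_three_odd_isPrimitive_ratMinusTwistedSymbolSum_ne_zero_unconditional`, `CuspEval.exists_cuspElement_not_mem_unconditional` —
  w2 g6's supply / generation theorems (p628930, p631647) with the Rohrlich hypothesis DISCHARGED by the tree theorem (one-liners; for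
  the K2 column and any consumer of the `∀ rational newform of odd level` shape).
* `cuspBrick_unconditional` — brick B1 in the socket's binder shape (`hB1` of the lead's
  `KatoBK.corePairChiPrim_of_coreKBK_of_bricks`, p634009), for EVERY normalised newform of odd level with rational coefficients and
  WITHOUT any hypothesis: it is w3 g7's `KatoBK.cuspBrick_of_rohrlich` (p633616) fed with the tree's DISCHARGE of Rohrlich's theorem,
  `Literature.NumberTheory.EllipticCurves.Rohrlich1984_nonvanishing_twists_holds` (Rankin–Selberg power saving,
  `RohrlichNonvanishingRankinProofs`; axioms `propext`, `Classical.choice`, `Quot.sound`). So the named fact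
  `Rohrlich1984_nonvanishing_twists` is NOT an input of the K3 chain in any shape.
* The socket compositions — `KatoBK.corePairChiPrim_of_coreKBKStd` (CORE_KBK_std ⟹ CORE_pairχ^prim with all four kernel bricks
  discharged by name) and the certificates K3P′ ⟸ CORE_KBK_std alone, K3 ⟸ {Kato Thm. 13.4 (2) at `2`, GZK, CORE_KBK_std} (and their RTT
  readings) — are appended to this file / live in the companion `…OfPubKBKCertificates.lean` once the PINNED socket
  `KatoBK.corePairChiPrim_of_coreKBKStd_of_bricks` (`…KatoBKSocketStd`, w5 g2; the lead's 12:54:04Z reshape: Kato's complex embeddings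
  `ιC` pinned by `ιC(ζ_{2^k}) = exp(2πi/2^k)`, since the unpinned CORE_KBK of p634009 is refutable, memo `W5G2-IOTA-PIN`) is in the tree.

CORE_KBK_std (the lead's socket binder with the `ιC` pin, memo `G7-ASSEMBLY-v1` §1 + `W5G2-IOTA-PIN`) is the HONEST published residue
of the line: Kato's `2`-adic zeta elements with their `exp*`-values for every admissible `(c, d, a, A)` (tree fact
SHAPE `Kato2004.EulerSystemValues.ZetaBody`; Kato 2004 Ex. 13.3, Thm. 9.7, Thm. 6.6, Thm. 12.5 (1)) TOGETHER WITH the Bloch–Kato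
reciprocity clause (C6) for the SAME dual-exponential datum `Λ_K` on the layer pairings `⟨Cor y, Q⟩ = Tr(log_ω Q · exp*_ω y)`
(Bloch–Kato 1990 (3.10.1)/(3.11.1), Kato LNM 1553 II Thm. 1.4.1). It is NOT proved here and is not claimed to be a tree fact.

References: K. Kato, Astérisque 295 (2004) [Kato2004Asterisque]; S. Bloch, K. Kato, in: The Grothendieck Festschrift I (1990) §3
[BlochKato1990]; S. Kobayashi, Invent. Math. 152 (2003) [Kobayashi2003]; D. Rohrlich, Invent. Math. 75 (1984)
[RohrlichInventiones1984]; B. Gross, D. Zagier, Invent. Math. 84 (1986) [GrossZagier1986]; V. Kolyvagin, Progr. Math. 87 (1990)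
[Kolyvagin1990].
-/

set_option autoImplicit false
-- the Theorems namespace of this sub repeats the summit name by design (D-0017 nested layout)
set_option linter.dupNamespace false

noncomputable section

set_option backward.isDefEq.respectTransparency false

open scoped BigOperators

open CongruenceSubgroup Literature.NumberTheory.EllipticCurves Literature.NumberTheory.EllipticCurves.ModularForms

namespace Summit.BirchSwinnertonDyer.BirchSwinnertonDyer.Theorems.SignedKatoOffTwo

/-! ## §0 The w2 g6 supply chain with NO hypothesis (Rohrlich's theorem is discharged in the tree) -/

/-- **Three odd primitive characters with non-vanishing minus twisted symbol sum, unconditionally**: for a normalised newform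
`f ∈ S₂(Γ₀(N))` with rational coefficients and `2 ∤ N`, for every `e₀` there are `e ≥ max(e₀, 3)` and three distinct odd primitive
Dirichlet characters `ψ` modulo `2^e` with `ratMinusTwistedSymbolSum f ψ ≠ 0` — w2 g6's
`OddTwistSupply.exists_three_odd_isPrimitive_ratMinusTwistedSymbolSum_ne_zero` fed with the tree THEOREM
`Rohrlich1984_nonvanishing_twists_holds`. [cite: RohrlichInventiones1984, Theorem (p. 409)] [cite: Kato2004Asterisque, Thm. 13.5 (2) (p. 227), §13.12 (pp. 231–233)] -/
theorem OddTwistSupply.exists_three_odd_isPrimitive_ratMinusTwistedSymbolSum_ne_zero_unconditional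
    {N : ℕ} [NeZero N] {f : CuspForm (Gamma0 N) 2} (hf : IsNewform0 f) (hQ : coeffField f = ⊥) (h2 : ¬ 2 ∣ N) (e₀ : ℕ) :
    ∃ e : ℕ, e₀ ≤ e ∧ 3 ≤ e ∧ ∃ ψ : Fin 3 → DirichletCharacter ℂ (2 ^ e),
      Function.Injective ψ ∧ ∀ i, (ψ i).Odd ∧ (ψ i).IsPrimitive ∧ ratMinusTwistedSymbolSum f (ψ i) ≠ 0 :=
  OddTwistSupply.exists_three_odd_isPrimitive_ratMinusTwistedSymbolSum_ne_zero Rohrlich1984_nonvanishing_twists_holds hf hQ h2 e₀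

/-- **Cusp-factor generation in modular-symbol currency, unconditionally** (w2 g6's `CuspEval.exists_cuspElement_not_mem_of_rohrlich`
fed with the tree THEOREM `Rohrlich1984_nonvanishing_twists_holds`): for a rational newform `f` of odd level `N`, every height-one prime
`𝔭 ∌ 2` of `ℤ₂⟦T⟧`, every `η` (here `eta`), avoidance moduli `Qc` (prime to `10`), `Qd` (odd) and every `e₀`, a level `e ≥ max(e₀, 3)`, a cusp class
`a`, a scaling `D ≥ 1` with `t(b) = D·[ab/2^e]⁻_f ∈ ℤ` and admissible `c, d` with the four-term cusp element OUTSIDE `𝔭` (Kato's §13.12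
choice at `p = 2`). [cite: Kato2004Asterisque, Thm. 12.6 (p. 222), §13.12 (pp. 231–233), Thm. 13.5 (2) (p. 227)]
[cite: RohrlichInventiones1984, Theorem (p. 409)] -/
theorem CuspEval.exists_cuspElement_not_mem_unconditional
    {N : ℕ} [NeZero N] {f : CuspForm (Gamma0 N) 2} (hf : IsNewform0 f) (hQf : coeffField f = ⊥) (h2N : ¬ 2 ∣ N)
    {Qc Qd : ℕ} (hQc2 : Nat.Coprime 2 Qc) (hQc5 : Nat.Coprime 5 Qc) (hQd : Nat.Coprime 2 Qd) (eta : ℤ_[2])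
    (𝔭 : PrimeSpectrum (IwasawaAlgebra 2)) (h𝔭 : 𝔭.asIdeal.height = 1) (h2 : PowerSeries.C (2 : ℤ_[2]) ∉ 𝔭.asIdeal) (e₀ : ℕ) :
    ∃ e : ℕ, e₀ ≤ e ∧ 3 ≤ e ∧ ∃ (a : (ZMod (2 ^ e))ˣ) (D : ℕ) (t : (ZMod (2 ^ e))ˣ → ℤ), 0 < D ∧
      (∀ b : (ZMod (2 ^ e))ˣ, (t b : ℚ) = D * ratMinusSymbol f ((((a * b : (ZMod (2 ^ e))ˣ) : ZMod (2 ^ e)).val : ℚ) / 2 ^ e)) ∧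
      ∃ (c d : ℕ) (uc ud : ℤ_[2]ˣ) (cb db : (ZMod (2 ^ e))ˣ),
        (uc : ℤ_[2]) = c ∧ (ud : ℤ_[2]) = d ∧ (cb : ZMod (2 ^ e)) = c ∧ (db : ZMod (2 ^ e)) = d ∧
        Nat.Coprime c (2 * Qc) ∧ Nat.Coprime d (2 * Qd) ∧
        PowerSeries.C ((c ^ 2 * d ^ 2 * t 1 : ℤ) : ℤ_[2])
            - PowerSeries.C ((c * d ^ 2 * t cb : ℤ) : ℤ_[2]) * PowerSeries.binomialSeries ℤ_[2] (eta * CyclotomicZp.ell 2 uc)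
            - PowerSeries.C ((c ^ 2 * d * t db⁻¹ : ℤ) : ℤ_[2]) * PowerSeries.binomialSeries ℤ_[2] (eta * CyclotomicZp.ell 2 ud)
            + PowerSeries.C ((c * d * t (cb * db⁻¹) : ℤ) : ℤ_[2]) * PowerSeries.binomialSeries ℤ_[2] (eta * CyclotomicZp.ell 2 uc) *
                PowerSeries.binomialSeries ℤ_[2] (eta * CyclotomicZp.ell 2 ud) ∉ 𝔭.asIdeal :=
  CuspEval.exists_cuspElement_not_mem_of_rohrlich Rohrlich1984_nonvanishing_twists_holds hf hQf h2N hQc2 hQc5 hQd eta 𝔭 h𝔭 h2 e₀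

end Summit.BirchSwinnertonDyer.BirchSwinnertonDyer.Theorems.SignedKatoOffTwo

namespace Summit.BirchSwinnertonDyer.BirchSwinnertonDyer.Theorems.SignedKatoOffTwo.KatoBK

/-! ## §1 Brick B1 in the socket's binder shape with NO hypothesis -/

/-- **Brick B1 in the socket's binder shape, unconditionally**: for every normalised newform `f ∈ S₂(Γ₀(N))` with rational
coefficients and `2 ∤ N`, and every height-one prime `𝔭 ∌ 2` of `Λ = ℤ₂⟦T⟧`, Kato's integer data `(c, d, a, A = 2^{ee}, d′, D)` and a
four-term cusp element `μ̃ ∈ Λ ∖ 𝔭` whose value at every even `2`-power-order character `χ` mod `2^{n+2}` is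
`D·(c²d²[a/A]⁻ − cd²χ(c)[ac/A]⁻ − c²dχ(d)[ad′/A]⁻ + cdχ(c)χ(d)[acd′/A]⁻)`. This is w3 g7's `cuspBrick_of_rohrlich` applied to the
tree THEOREM `Rohrlich1984_nonvanishing_twists_holds` (Rohrlich 1984, Theorem 1, discharged by a Rankin–Selberg power saving), so no
named fact remains. [cite: Kato2004Asterisque, Thm. 12.6 (p. 222), §13.12 (pp. 231–233), Ex. 13.3 (p. 225)]
[cite: RohrlichInventiones1984, Theorem (p. 409)] -/
theorem cuspBrick_unconditional :
    ∀ {N : ℕ} [NeZero N] (f : CuspForm (Gamma0 N) 2), IsNewform0 f → coeffField f = ⊥ → ¬ 2 ∣ N →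
      ∀ 𝔭 : PrimeSpectrum (IwasawaAlgebra 2), 𝔭.asIdeal.height = 1 → PowerSeries.C (2 : ℤ_[2]) ∉ 𝔭.asIdeal →
      ∃ (c d a : ℤ) (ee : ℕ) (d' D : ℤ) (μt : IwasawaAlgebra 2),
        Int.gcd c (6 * 2 * 2 ^ ee) = 1 ∧ Int.gcd d (6 * 2 * N) = 1 ∧ d * d' ≡ 1 [ZMOD ((2 ^ ee : ℕ) : ℤ)] ∧ D ≠ 0 ∧
        μt ∉ 𝔭.asIdeal ∧
        ∀ (n : ℕ) (χ : DirichletCharacter ℂ_[2] (2 ^ (n + 2))), χ.Even → (∃ j : ℕ, orderOf χ = 2 ^ j) →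
          HasSum (fun k ↦ ((algebraMap ℚ_[2] ℂ_[2]).comp (algebraMap ℤ_[2] ℚ_[2])) (PowerSeries.coeff k μt) *
              (χ (5 : ZMod (2 ^ (n + 2))) - 1) ^ k)
            ((D : ℂ_[2]) * ((c : ℂ_[2]) ^ 2 * (d : ℂ_[2]) ^ 2 * ((ratMinusSymbol f ((a : ℚ) / (2 ^ ee : ℕ)) : ℚ) : ℂ_[2])
              - (c : ℂ_[2]) * (d : ℂ_[2]) ^ 2 * χ (c : ZMod (2 ^ (n + 2))) *
                  ((ratMinusSymbol f ((a * c : ℚ) / (2 ^ ee : ℕ)) : ℚ) : ℂ_[2])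
              - (c : ℂ_[2]) ^ 2 * (d : ℂ_[2]) * χ (d : ZMod (2 ^ (n + 2))) *
                  ((ratMinusSymbol f ((a * d' : ℚ) / (2 ^ ee : ℕ)) : ℚ) : ℂ_[2])
              + (c : ℂ_[2]) * (d : ℂ_[2]) * (χ (c : ZMod (2 ^ (n + 2))) * χ (d : ZMod (2 ^ (n + 2)))) *
                  ((ratMinusSymbol f ((a * c * d' : ℚ) / (2 ^ ee : ℕ)) : ℚ) : ℂ_[2]))) :=
  cuspBrick_of_rohrlich Rohrlich1984_nonvanishing_twists_holds

end Summit.BirchSwinnertonDyer.BirchSwinnertonDyer.Theorems.SignedKatoOffTwo.KatoBK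

end
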